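import Literature.NumberTheory.Rogawski1990.EndoscopicClassTransfer
import Literature.NumberTheory.Automorphic.UnitaryGroupStableOrbitalIntegral
import HarnessLib

/-!
# Stable-class GROUPING on the endoscopic group `H = U(J₂) × U(J₁)`: `𝒪′_st ↦ Σ_{[γ_H] ⊂ 𝒪′_st} Φ[γ_H]` for a class function `Φ`,
# the regrouping `Σ_{[γ_H]} = Σ_{𝒪′_st} Σ_{[γ_H] ⊂ 𝒪′_st}`, its LOCAL reading (typ1's `Φ^st_H(γ_H, f^H)`) and its GLOBAL reading
# (rational classes of `H(L⁺)`, adelic orbital integrals) (Rogawski 1990, (4.1.1) p. 40, (4.3.1) p. 43, §5.2 p. 69, §5.4 pp. 71–78)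

Topic `NumberTheory/Rogawski1990`; namespace `Literature.NumberTheory.Rogawski1990`; DEFINITIONS with bodies + theorems; no named fact, no
`sorry`, no instance, no notation.  The `H`-side twin of ★ `StableClassRegrouping` (p08) and of §1–§2 of ★ `UnitaryGroupStableOrbitalIntegral` (p04,
T1b-3), on top of ★ `EndoscopicClassTransfer` (`StableClassH`, T1b-4), ★ typ1's `LocalTransfer` (`IsStablyConjH`, `stableOrbitalIntegralH`) and p04's
generic ★ `classOrbitalIntegralAlong ι` (orbital integrals in `G` indexed by the classes of `Γ` along `ι : Γ →* G`).

CURRENCIES (planner ruling 2026-08-31T00:59Z on SPEC §3 (ix), recorded so that nothing here is mis-pinned).  [Rogawski1990, (4.1.1) p. 40; (4.3.1)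
p. 43]: LOCALLY, `Φ^st(γ_H, f^H_v) = Σ_{[γ′] ⊂ 𝒪_st(γ_H)} Φ(γ′, f^H_v)` sums over the conjugacy classes of `H(F_v)` inside a stable class — §3 below
(★ typ1's `stableOrbitalIntegralH` IS `StableClassH.orbitalSum` of the local class orbital integrals).  GLOBALLY there are TWO different sums:
(a) [§5.2 p. 69, §5.4 (5.4.1) p. 71] the geometric side grouped by stable classes, `J_H(𝒪′_st, f^H) = Σ` over the RATIONAL classes `[γ_H] ⊂ 𝒪′_st`
of `H(L⁺)` of the adelic orbital integrals `Φ(γ_H, f^H) = ∫_{H_{γ_H}(𝔸)\H(𝔸)}` — this is §4's `adelicStableOrbitalSumH` (the currency of `H`'s OWN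
trace formula, laws T1c∕T1d); (b) [§5.4 p. 77; Prop. 10.1.2] the `Φ^st(γ_H, f^H) = Σ` over the ADELIC classes in `𝒪′_st(𝔸)` `= Π_v Φ^st_v` entering
`SJ_H(𝒪′_st, f^H) = ε_st(γ_H, H)⁻¹ z_H(γ_H) λ_H⁻¹ τ(H) Φ^st(γ_H, f^H)` of [Prop. 5.4.1] — NOT typed here (it needs the Euler factorisation of
pure-tensor orbital integrals and local stable orbital integrals at every place, incl. archimedean); §4 is NOT a pin for the line's `SJH`.

* §1 `StableClassH.ofConjClass : ConjClasses H(F) → StableClassH σ J₂ J₁` (a stable class is a union of conjugacy classes) and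
  **`StableClassH.orbitalSum Φ : StableClassH σ J₂ J₁ → S`**, `𝒪′_st ↦ Σᶠ_{[γ_H] ↦ 𝒪′_st} Φ[γ_H]` for an INPUT class function `Φ`;
* §2 regrouping for finitely supported `Φ`: `finsum_stableClassH_orbitalSum` (`Σᶠ_{𝒪′_st} Σᶠ_{[γ_H] ⊂ 𝒪′_st} = Σᶠ_{[γ_H]}`), finite support, weights
  constant on stable classes factor out (`StableClassH.orbitalSum_mul_of_fibrewise`);
* §3 LOCAL currency: ★ typ1's `stableOrbitalIntegralH σ J₂ J₁ m_H f^H γ_H = (𝒪′_st(γ_H)).orbitalSum (classOrbitalIntegral m_H f^H)`;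
* §4 GLOBAL currency (a): `ιH L J₂ J₁ : U(J₂)(L⁺) × U(J₁)(L⁺) →* U(J₂)(𝔸) × U(J₁)(𝔸)` (product of the diagonal embeddings of ★ `cmDatum`),
  `AdelicOrbitalMeasureFamilyH`, `adelicClassOrbitalIntegralH`, **`adelicStableOrbitalSumH L J₂ J₁ m f^H : StableClassH (cmConjRingHom L) J₂ J₁ → ℂ`**
  (`J_H(𝒪′_st, f^H)` up to the consumer's weights, cf. `_mul_weight`), with `_zero_fun`, `_smul`, regrouping; and the FINITE sum `Σ_{𝒪′ ↦ 𝒪}` over the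
  classes of `H` transferring to a class of an inner form (★ T1b-4 `finite_subtype_transfersTo`), valid for ANY function of the `H`-classes.
-/

noncomputable section

open MeasureTheory

namespace Literature.NumberTheory.Rogawski1990

open scoped MatrixGroups
open Literature.AlgebraicGeometry.ShimuraVarieties (unitaryGroup)
open Literature.NumberTheory.Automorphic (OrbitalMeasureFamily classOrbitalIntegral OrbitalMeasureFamilyAlong classOrbitalIntegralAlong
  classOrbitalIntegralAlong_zero_fun classOrbitalIntegralAlong_smul)

/-! ## §1 `[γ_H] ↦ 𝒪′_st(γ_H)` and the stable orbital sum `Φ^st_H(𝒪′_st)` -/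

section General

variable {R : Type*} [CommRing R] {σ : R →+* R} {J₂ : Matrix (Fin 2) (Fin 2) R} {J₁ : Matrix (Fin 1) (Fin 1) R}

/-- A stable class of `H(F)` is a union of conjugacy classes: `[γ_H] ↦ 𝒪′_st(γ_H)` (★ `isStablyConjH_of_isConj`). [cite: Rogawski1990, §3.1 p. 19] -/
def StableClassH.ofConjClass : ConjClasses (unitaryGroup σ J₂ × unitaryGroup σ J₁) → StableClassH σ J₂ J₁ :=
  Quotient.lift (s := IsConj.setoid _) (stableClassHOf σ J₂ J₁) fun _ _ h => stableClassHOf_eq_iff.mpr (isStablyConjH_of_isConj h)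

/-- `ofConjClass [γ_H] = 𝒪′_st(γ_H)`. [cite: Rogawski1990, §3.1 p. 19] -/
@[simp] theorem StableClassH.ofConjClass_mk (a : unitaryGroup σ J₂ × unitaryGroup σ J₁) :
    StableClassH.ofConjClass (ConjClasses.mk a) = stableClassHOf σ J₂ J₁ a := rfl

/-- `[γ_H] ↦ 𝒪′_st(γ_H)` is surjective. [cite: Rogawski1990, §3.1 p. 19] -/
theorem StableClassH.ofConjClass_surjective :
    Function.Surjective (StableClassH.ofConjClass : ConjClasses (unitaryGroup σ J₂ × unitaryGroup σ J₁) → StableClassH σ J₂ J₁) := by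
  intro s
  obtain ⟨a, rfl⟩ := stableClassHOf_surjective s
  exact ⟨ConjClasses.mk a, rfl⟩

/-- `[δ_H] ⊂ 𝒪′_st(γ_H) ↔ γ_H ∼_st δ_H`. [cite: Rogawski1990, §4.1 (4.1.1) p. 39] -/
theorem StableClassH.mk_mem_preimage_ofConjClass_iff {a b : unitaryGroup σ J₂ × unitaryGroup σ J₁} :
    ConjClasses.mk b ∈ StableClassH.ofConjClass ⁻¹' {stableClassHOf σ J₂ J₁ a} ↔ IsStablyConjH σ J₂ J₁ a b := by
  rw [Set.mem_preimage, Set.mem_singleton_iff, StableClassH.ofConjClass_mk, stableClassHOf_eq_iff]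
  exact ⟨IsStablyConjH.symm, IsStablyConjH.symm⟩

variable {S : Type*} [CommRing S]

/-- **The stable orbital sum on `H`: `Φ^st_H(𝒪′_st) = Σᶠ_{[γ_H] ⊂ 𝒪′_st} Φ[γ_H]`** for an INPUT class function `Φ` on the conjugacy classes of
`H(F) = U(σ,J₂)(R) × U(σ,J₁)(R)` (e.g. `[γ_H] ↦ Φ(γ_H, f^H)` local or global; a `finsum`, `0` if infinitely many classes contribute).
[cite: Rogawski1990, §4.3 (4.3.1) p. 43] -/
def StableClassH.orbitalSum (Φ : ConjClasses (unitaryGroup σ J₂ × unitaryGroup σ J₁) → S) (s : StableClassH σ J₂ J₁) : S :=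
  ∑ᶠ c ∈ StableClassH.ofConjClass ⁻¹' {s}, Φ c

/-- Unfolding. [cite: Rogawski1990, §4.3 (4.3.1) p. 43] -/
theorem StableClassH.orbitalSum_eq_finsum_mem_preimage (Φ : ConjClasses (unitaryGroup σ J₂ × unitaryGroup σ J₁) → S) (s : StableClassH σ J₂ J₁) :
    s.orbitalSum Φ = ∑ᶠ c ∈ StableClassH.ofConjClass ⁻¹' {s}, Φ c := rfl

/-- `Φ^st_H(𝒪′_st)` for `Φ = 0` is `0`. [cite: Rogawski1990, §4.3 (4.3.1) p. 43] -/
@[simp] theorem StableClassH.orbitalSum_zero (s : StableClassH σ J₂ J₁) :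
    s.orbitalSum (0 : ConjClasses (unitaryGroup σ J₂ × unitaryGroup σ J₁) → S) = 0 :=
  finsum_mem_eq_zero_of_forall_eq_zero fun _ _ => rfl

/-- Scalars factor: `(a • Φ)^st_H = a • Φ^st_H`. [cite: Rogawski1990, §4.3 (4.3.1) p. 43] -/
theorem StableClassH.orbitalSum_smul [NoZeroDivisors S] (a : S) (Φ : ConjClasses (unitaryGroup σ J₂ × unitaryGroup σ J₁) → S) (s : StableClassH σ J₂ J₁) :
    s.orbitalSum (a • Φ) = a * s.orbitalSum Φ := by
  rw [StableClassH.orbitalSum, StableClassH.orbitalSum, mul_finsum_mem]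
  rfl

/-- If `𝒪′_st(γ_H)` is a single conjugacy class then `Φ^st_H(𝒪′_st(γ_H)) = Φ[γ_H]`. [cite: Rogawski1990, §14.2 p. 232] -/
theorem StableClassH.orbitalSum_eq_of_forall_isConj (Φ : ConjClasses (unitaryGroup σ J₂ × unitaryGroup σ J₁) → S)
    {a : unitaryGroup σ J₂ × unitaryGroup σ J₁} (h : ∀ b, IsStablyConjH σ J₂ J₁ a b → IsConj a b) :
    (stableClassHOf σ J₂ J₁ a).orbitalSum Φ = Φ (ConjClasses.mk a) := by
  have hs : StableClassH.ofConjClass ⁻¹' {stableClassHOf σ J₂ J₁ a} = {ConjClasses.mk a} := by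
    ext c
    obtain ⟨b, rfl⟩ := ConjClasses.mk_surjective c
    rw [StableClassH.mk_mem_preimage_ofConjClass_iff, Set.mem_singleton_iff, ConjClasses.mk_eq_mk_iff_isConj]
    exact ⟨fun h' => (h b h').symm, fun h' => isStablyConjH_of_isConj h'.symm⟩
  rw [StableClassH.orbitalSum, hs, finsum_mem_singleton]

/-! ## §2 Regrouping `Σ_{[γ_H]} = Σ_{𝒪′_st} Σ_{[γ_H] ⊂ 𝒪′_st}` for finitely supported `Φ` -/

/-- With `Φ` finitely supported, `Φ^st_H(𝒪′_st)` is a `Finset` sum over the classes of the support inside `𝒪′_st`. [cite: Rogawski1990, §14.5 p. 240] -/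
theorem StableClassH.orbitalSum_eq_sum_filter [DecidableEq (StableClassH σ J₂ J₁)] (Φ : ConjClasses (unitaryGroup σ J₂ × unitaryGroup σ J₁) → S)
    (hΦ : (Function.support Φ).Finite) (s : StableClassH σ J₂ J₁) :
    s.orbitalSum Φ = ∑ c ∈ hΦ.toFinset with StableClassH.ofConjClass c = s, Φ c := by
  classical
  rw [StableClassH.orbitalSum_eq_finsum_mem_preimage, finsum_mem_eq_sum_filter Φ _ (show Function.HasFiniteSupport Φ from hΦ)]
  refine Finset.sum_congr ?_ fun _ _ => rfl
  ext c
  simp only [Finset.mem_filter, Set.Finite.mem_toFinset, Set.mem_preimage, Set.mem_singleton_iff]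

/-- … so only finitely many stable classes carry a non-zero `Φ^st_H` (images of the support). [cite: Rogawski1990, §14.5 p. 240] -/
theorem StableClassH.support_orbitalSum_subset [DecidableEq (StableClassH σ J₂ J₁)] (Φ : ConjClasses (unitaryGroup σ J₂ × unitaryGroup σ J₁) → S)
    (hΦ : (Function.support Φ).Finite) :
    Function.support (fun s : StableClassH σ J₂ J₁ => s.orbitalSum Φ) ⊆ ↑(hΦ.toFinset.image StableClassH.ofConjClass) := by
  intro s hs
  rw [Function.mem_support, StableClassH.orbitalSum_eq_sum_filter Φ hΦ] at hs
  obtain ⟨c, hc, -⟩ := Finset.exists_ne_zero_of_sum_ne_zero hs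
  rw [Finset.mem_filter] at hc
  exact Finset.mem_coe.mpr (Finset.mem_image.mpr ⟨c, hc.1, hc.2⟩)

/-- `𝒪′_st ↦ Φ^st_H(𝒪′_st)` is finitely supported when `Φ` is. [cite: Rogawski1990, §14.5 p. 240] -/
theorem StableClassH.finite_support_orbitalSum (Φ : ConjClasses (unitaryGroup σ J₂ × unitaryGroup σ J₁) → S) (hΦ : (Function.support Φ).Finite) :
    (Function.support fun s : StableClassH σ J₂ J₁ => s.orbitalSum Φ).Finite := by
  classical
  exact (Finset.finite_toSet _).subset (StableClassH.support_orbitalSum_subset Φ hΦ)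

/-- **Regrouping by stable classes of `H`**: `Σᶠ_{𝒪′_st} Φ^st_H(𝒪′_st) = Σᶠ_{[γ_H]} Φ[γ_H]` for finitely supported `Φ`. [cite: Rogawski1990, §14.5 p. 240] -/
theorem finsum_stableClassH_orbitalSum (Φ : ConjClasses (unitaryGroup σ J₂ × unitaryGroup σ J₁) → S) (hΦ : (Function.support Φ).Finite) :
    ∑ᶠ s : StableClassH σ J₂ J₁, s.orbitalSum Φ = ∑ᶠ c, Φ c := by
  classical
  rw [finsum_eq_sum_of_support_subset _ (StableClassH.support_orbitalSum_subset Φ hΦ),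
    finsum_eq_sum_of_support_subset Φ (by rw [hΦ.coe_toFinset])]
  simp_rw [StableClassH.orbitalSum_eq_sum_filter Φ hΦ]
  exact Finset.sum_fiberwise_of_maps_to (fun c hc => Finset.mem_image_of_mem _ hc) Φ

/-- **Weights constant on stable classes factor out** (e.g. the stable-class coefficients of (5.4.1)–(5.4.3)): if `w[γ_H] = W(𝒪′_st(γ_H))` then
`(w·Φ)^st_H(𝒪′_st) = W(𝒪′_st) · Φ^st_H(𝒪′_st)`. [cite: Rogawski1990, §5.4 (5.4.1) p. 71] -/
theorem StableClassH.orbitalSum_mul_of_fibrewise [NoZeroDivisors S] (Φ w : ConjClasses (unitaryGroup σ J₂ × unitaryGroup σ J₁) → S)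
    (W : StableClassH σ J₂ J₁ → S) (hw : ∀ c, w c = W (StableClassH.ofConjClass c)) (s : StableClassH σ J₂ J₁) :
    s.orbitalSum (fun c => w c * Φ c) = W s * s.orbitalSum Φ := by
  rw [StableClassH.orbitalSum, StableClassH.orbitalSum, mul_finsum_mem]
  refine finsum_mem_congr rfl fun c hc => ?_
  rw [Set.mem_preimage, Set.mem_singleton_iff] at hc
  rw [hw c, hc]

/-! ## §3 ★ typ1's element-level `Φ^st_H(γ_H, f^H)` is the stable orbital sum of the class orbital integrals -/

/-- The index set `{[γ′] | γ_H ∼_st out [γ′]}` of ★ `stableOrbitalIntegralH` is the fibre of `[·] ↦ 𝒪′_st(·)` over `𝒪′_st(γ_H)`.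
[cite: Rogawski1990, §4.3 (4.3.1) p. 43] -/
theorem StableClassH.setOf_isStablyConjH_out_eq_preimage (a : unitaryGroup σ J₂ × unitaryGroup σ J₁) :
    {c : ConjClasses (unitaryGroup σ J₂ × unitaryGroup σ J₁) | IsStablyConjH σ J₂ J₁ a (Quotient.out c)} =
      StableClassH.ofConjClass ⁻¹' {stableClassHOf σ J₂ J₁ a} := by
  ext c
  rw [Set.mem_setOf_eq]
  conv_rhs => rw [← Quotient.out_eq c]
  change _ ↔ ConjClasses.mk (Quotient.out c) ∈ StableClassH.ofConjClass ⁻¹' {stableClassHOf σ J₂ J₁ a}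
  rw [StableClassH.mk_mem_preimage_ofConjClass_iff]

/-- **`Φ^st_H(γ_H, f^H)` (★ `stableOrbitalIntegralH`, typ1) `= (𝒪′_st(γ_H)).orbitalSum ([γ′] ↦ Φ([γ′], f^H))`** for any orbital measure family
`m_H` on `H(F)`. [cite: Rogawski1990, §4.3 (4.3.1) p. 43] -/
theorem stableOrbitalIntegralH_eq_orbitalSum
    [∀ a : unitaryGroup σ J₂ × unitaryGroup σ J₁,
      MeasurableSpace ((unitaryGroup σ J₂ × unitaryGroup σ J₁) ⧸ Subgroup.centralizer ({a} : Set (unitaryGroup σ J₂ × unitaryGroup σ J₁)))]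
    (mH : OrbitalMeasureFamily (unitaryGroup σ J₂ × unitaryGroup σ J₁)) (fH : unitaryGroup σ J₂ × unitaryGroup σ J₁ → ℂ)
    (a : unitaryGroup σ J₂ × unitaryGroup σ J₁) :
    stableOrbitalIntegralH σ J₂ J₁ mH fH a = (stableClassHOf σ J₂ J₁ a).orbitalSum (classOrbitalIntegral mH fH) := by
  rw [stableOrbitalIntegralH, stableOrbitalIntegralRel, StableClassH.setOf_isStablyConjH_out_eq_preimage, StableClassH.orbitalSum]

end General

/-! ## §4 GLOBAL currency (a): `J_H(𝒪′_st, f^H) = Σ` over the RATIONAL classes `[γ_H] ⊂ 𝒪′_st` of adelic orbital integrals on `H(𝔸)` -/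

section Global

open NumberField
open Literature.NumberTheory.Automorphic (cmConjRingHom)
open Literature.NumberTheory.Automorphic.UnitaryGroup (cmDatum)

variable (L : Type) [Field L] [NumberField L] [IsCMField L] (J₂ : Matrix (Fin 2) (Fin 2) L) (J₁ : Matrix (Fin 1) (Fin 1) L)

/-- **The diagonal embedding `H(L⁺) →* H(𝔸_{L⁺})` of `H = U(J₂) × U(J₁)`**: the product of the embeddings ★ `(cmDatum L 2 J₂).toAdelic` and
★ `(cmDatum L 1 J₁).toAdelic` (for `J₂ = Φ₂`, `J₁ = Φ₁` the target is the line's `HAdelic L`). [cite: Rogawski1990, §5.4 p. 71] -/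
def ιH : ↥(unitaryGroup (cmConjRingHom L) J₂) × ↥(unitaryGroup (cmConjRingHom L) J₁) →* (cmDatum L 2 J₂).Adelic × (cmDatum L 1 J₁).Adelic :=
  MonoidHom.prodMap (cmDatum L 2 J₂).toAdelic (cmDatum L 1 J₁).toAdelic

/-- `ιH (γ₂, γ₁) = (toAdelic γ₂, toAdelic γ₁)`. [cite: Rogawski1990, §5.4 p. 71] -/
@[simp] theorem ιH_apply (a : ↥(unitaryGroup (cmConjRingHom L) J₂) × ↥(unitaryGroup (cmConjRingHom L) J₁)) :
    ιH L J₂ J₁ a = ((cmDatum L 2 J₂).toAdelic a.1, (cmDatum L 1 J₁).toAdelic a.2) := rfl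

/-- **`Σ_{𝒪′ ↦ 𝒪} F(𝒪′)` over the stable classes of `H` transferring to a class `𝒪` of an inner form `U(J₃′)(L⁺)` is a FINITE sum** for ANY `F` (at most
`3` terms, ★ T1b-4 `finite_subtype_transfersTo`): the `finsum` equals the `Finset` sum over `Finite.toFinset`. [cite: Rogawski1990, §5.4 Prop. 5.4.1 p. 77–78] -/
theorem finsum_subtype_transfersTo_eq_sum {J₃ J₃' : Matrix (Fin 3) (Fin 3) L} (h : endoForm J₂ J₁ = J₃) (c : StableClass (cmConjRingHom L) J₃')
    (F : StableClassH (cmConjRingHom L) J₂ J₁ → ℂ) :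
    ∑ᶠ c' : {c' : StableClassH (cmConjRingHom L) J₂ J₁ // c'.TransfersTo J₃' h c}, F c'.1 =
      ∑ c' ∈ (StableClassH.finite_setOf_transfersTo h c).toFinset, F c' := by
  rw [← finsum_mem_eq_finite_toFinset_sum F (StableClassH.finite_setOf_transfersTo h c)]
  exact finsum_set_coe_eq_finsum_mem {c' : StableClassH (cmConjRingHom L) J₂ J₁ | c'.TransfersTo J₃' h c}

variable [∀ g : (cmDatum L 2 J₂).Adelic × (cmDatum L 1 J₁).Adelic,
  MeasurableSpace (((cmDatum L 2 J₂).Adelic × (cmDatum L 1 J₁).Adelic) ⧸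
    Subgroup.centralizer ({g} : Set ((cmDatum L 2 J₂).Adelic × (cmDatum L 1 J₁).Adelic)))]

/-- **Adelic orbital measures on `H(𝔸)` indexed by the RATIONAL classes of `H(L⁺)`** (★ `OrbitalMeasureFamilyAlong (ιH L J₂ J₁)`).
[cite: Rogawski1990, §5.4 p. 71] -/
abbrev AdelicOrbitalMeasureFamilyH : Type _ :=
  OrbitalMeasureFamilyAlong (ιH L J₂ J₁)

/-- **`[γ_H] ↦ Φ(γ_H, f^H) = ∫_{H_{γ_H}(𝔸)\H(𝔸)} f^H(g⁻¹ γ_H g) dg`** on the RATIONAL conjugacy classes of `H(L⁺)` (★ `classOrbitalIntegralAlong (ιH L J₂ J₁)`;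
the measures are a PARAMETER). [cite: Rogawski1990, §5.4 (5.4.1) p. 71] -/
abbrev adelicClassOrbitalIntegralH (m : AdelicOrbitalMeasureFamilyH L J₂ J₁) (fH : (cmDatum L 2 J₂).Adelic × (cmDatum L 1 J₁).Adelic → ℂ) :
    ConjClasses (↥(unitaryGroup (cmConjRingHom L) J₂) × ↥(unitaryGroup (cmConjRingHom L) J₁)) → ℂ :=
  classOrbitalIntegralAlong (ιH L J₂ J₁) m fH

/-- **`J_H(𝒪′_st, f^H)`-grouping: `𝒪′_st ↦ Σ_{[γ_H] ⊂ 𝒪′_st} Φ(γ_H, f^H)` over the RATIONAL classes of `H(L⁺)` inside the stable class** (adelic orbital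
integrals `Φ(γ_H, f^H) = ∫_{H_{γ_H}(𝔸)\H(𝔸)} f^H(g⁻¹ γ_H g) dg` at rational representatives; the geometric side of `H`'s own trace formula grouped by
stable classes as in [§5.2 p. 69], the `H`-twin of ★ p04's `adelicStableOrbitalIntegral`).  NOT the adelic `Φ^st(γ_H, f^H) = Π_v Φ^st_v` of `SJ_H`
([Prop. 5.4.1 p. 77], a sum over ADELIC classes), which is not typed here; weights and measure normalisations are the consumer's.
[cite: Rogawski1990, §5.2 p. 69] -/
def adelicStableOrbitalSumH (m : AdelicOrbitalMeasureFamilyH L J₂ J₁) (fH : (cmDatum L 2 J₂).Adelic × (cmDatum L 1 J₁).Adelic → ℂ) :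
    StableClassH (cmConjRingHom L) J₂ J₁ → ℂ :=
  StableClassH.orbitalSum (adelicClassOrbitalIntegralH L J₂ J₁ m fH)

variable (m : AdelicOrbitalMeasureFamilyH L J₂ J₁)

/-- Unfolding: `J_H(𝒪′_st, f^H) = Σᶠ` over the rational classes `[γ′] ⊂ 𝒪′_st` of `Φ(γ′_rep, f^H)`. [cite: Rogawski1990, §5.2 p. 69] -/
theorem adelicStableOrbitalSumH_eq (fH : (cmDatum L 2 J₂).Adelic × (cmDatum L 1 J₁).Adelic → ℂ) (s : StableClassH (cmConjRingHom L) J₂ J₁) :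
    adelicStableOrbitalSumH L J₂ J₁ m fH s = ∑ᶠ c ∈ StableClassH.ofConjClass ⁻¹' {s}, adelicClassOrbitalIntegralH L J₂ J₁ m fH c := rfl

/-- `J_H(𝒪′_st, 0) = 0`. [cite: Rogawski1990, §5.2 p. 69] -/
@[simp] theorem adelicStableOrbitalSumH_zero_fun :
    adelicStableOrbitalSumH L J₂ J₁ m (0 : (cmDatum L 2 J₂).Adelic × (cmDatum L 1 J₁).Adelic → ℂ) = 0 := by
  funext s
  rw [adelicStableOrbitalSumH, adelicClassOrbitalIntegralH, classOrbitalIntegralAlong_zero_fun]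
  exact StableClassH.orbitalSum_zero s

/-- `J_H(𝒪′_st, a • f^H) = a • J_H(𝒪′_st, f^H)`. [cite: Rogawski1990, §5.2 p. 69] -/
theorem adelicStableOrbitalSumH_smul (a : ℂ) (fH : (cmDatum L 2 J₂).Adelic × (cmDatum L 1 J₁).Adelic → ℂ) :
    adelicStableOrbitalSumH L J₂ J₁ m (a • fH) = a • adelicStableOrbitalSumH L J₂ J₁ m fH := by
  funext s
  rw [Pi.smul_apply, smul_eq_mul, adelicStableOrbitalSumH, adelicStableOrbitalSumH, ← StableClassH.orbitalSum_smul]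
  exact congrArg (fun Φ => StableClassH.orbitalSum Φ s) (classOrbitalIntegralAlong_smul (ιH L J₂ J₁) m a fH)

/-- If `𝒪′_st(γ_H)` is a single rational conjugacy class then `J_H(𝒪′_st(γ_H), f^H) = Φ([γ_H], f^H)`. [cite: Rogawski1990, §5.2 p. 69] -/
theorem adelicStableOrbitalSumH_eq_of_forall_isConj (fH : (cmDatum L 2 J₂).Adelic × (cmDatum L 1 J₁).Adelic → ℂ)
    {a : ↥(unitaryGroup (cmConjRingHom L) J₂) × ↥(unitaryGroup (cmConjRingHom L) J₁)}
    (h : ∀ b, IsStablyConjH (cmConjRingHom L) J₂ J₁ a b → IsConj a b) :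
    adelicStableOrbitalSumH L J₂ J₁ m fH (stableClassHOf (cmConjRingHom L) J₂ J₁ a) =
      adelicClassOrbitalIntegralH L J₂ J₁ m fH (ConjClasses.mk a) :=
  StableClassH.orbitalSum_eq_of_forall_isConj _ h

/-- `𝒪′_st ↦ J_H(𝒪′_st, f^H)` is finitely supported when `[γ_H] ↦ Φ(γ_H, f^H)` is. [cite: Rogawski1990, §5.2 p. 69] -/
theorem finite_support_adelicStableOrbitalSumH (fH : (cmDatum L 2 J₂).Adelic × (cmDatum L 1 J₁).Adelic → ℂ)
    (hf : (Function.support (adelicClassOrbitalIntegralH L J₂ J₁ m fH)).Finite) :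
    (Function.support (adelicStableOrbitalSumH L J₂ J₁ m fH)).Finite :=
  StableClassH.finite_support_orbitalSum _ hf

/-- **`J_H(f^H) = Σᶠ_{𝒪′_st} J_H(𝒪′_st, f^H) = Σᶠ_{[γ_H]} Φ([γ_H], f^H)`** for finitely supported class orbital integrals. [cite: Rogawski1990, §5.2 p. 69] -/
theorem finsum_adelicStableOrbitalSumH (fH : (cmDatum L 2 J₂).Adelic × (cmDatum L 1 J₁).Adelic → ℂ)
    (hf : (Function.support (adelicClassOrbitalIntegralH L J₂ J₁ m fH)).Finite) :
    ∑ᶠ s, adelicStableOrbitalSumH L J₂ J₁ m fH s = ∑ᶠ c, adelicClassOrbitalIntegralH L J₂ J₁ m fH c :=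
  finsum_stableClassH_orbitalSum _ hf

/-- **Stable-class weights factor**: `𝒪′_st.orbitalSum ([γ_H] ↦ w[γ_H] · Φ(γ_H, f^H)) = W(𝒪′_st) · J_H(𝒪′_st, f^H)` for `w = W ∘ ofConjClass` (the
coefficients `ε(γ)⁻¹ m(Z H_γ \ 𝐇_γ)` of the O-expansion depend on the stable class only). [cite: Rogawski1990, §5.4 (5.4.1) p. 71] -/
theorem adelicStableOrbitalSumH_mul_weight (fH : (cmDatum L 2 J₂).Adelic × (cmDatum L 1 J₁).Adelic → ℂ)
    (w : ConjClasses (↥(unitaryGroup (cmConjRingHom L) J₂) × ↥(unitaryGroup (cmConjRingHom L) J₁)) → ℂ)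
    (W : StableClassH (cmConjRingHom L) J₂ J₁ → ℂ)
    (hw : ∀ c, w c = W (StableClassH.ofConjClass c)) (s : StableClassH (cmConjRingHom L) J₂ J₁) :
    s.orbitalSum (fun c => w c * adelicClassOrbitalIntegralH L J₂ J₁ m fH c) = W s * adelicStableOrbitalSumH L J₂ J₁ m fH s :=
  StableClassH.orbitalSum_mul_of_fibrewise _ w W hw s

end Global

end Literature.NumberTheory.Rogawski1990
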